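import Summits.BirchSwinnertonDyer.BirchSwinnertonDyer.Theorems.Rank2Observatory2DescNormPrime
import HarnessLib

/-!
# BirchSwinnertonDyer — rank ≥ 2 observatory: irreducibility of the `2`-division cubic from one prime

HONEST FRAMING: per-curve certified theorems and census instruments; no claim on BSD in rank ≥ 2.

Generic addendum of the KERNEL-2DESC instrument (design `b2b-bsdr2-cert-3/KERNEL-2DESC.md` §4 A2,
production stage S4). The rational-root test `irreducible_polyQ_of_divisors` makes the kernel
enumerate `Nat.divisors |C|`, which is linear in `|C|` and unusable for the census curves with
`|C| ∼ 10⁷ … 10¹¹`. `irreducible_polyQ_of_no_root_mod` replaces it by the one-prime certificate: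
if `X³ + AX² + BX + C` has no root in `ZMod p` (any `p`; `decide` over `p` residues) it has no
rational root, hence — being a cubic — is irreducible over `ℚ`.

Sorry-free; axioms `propext`, `Classical.choice`, `Quot.sound`. [folklore]
-/

-- single-conjunct summit: `Summit.BirchSwinnertonDyer.BirchSwinnertonDyer.…` repeats the name by design
set_option linter.dupNamespace false

noncomputable section

open scoped Classical

open Literature.NumberTheory.NumberFields Polynomial

namespace Summit.BirchSwinnertonDyer.BirchSwinnertonDyer.Rank2Observatory.TwoDescCubic

/-- **One-prime irreducibility certificate**: a monic integer cubic with no root modulo `p` is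
irreducible over `ℚ` (integral root theorem + reduction mod `p`). [folklore] -/
theorem irreducible_polyQ_of_no_root_mod {a b c : ℤ} (p : ℕ)
    (h : ∀ t : ZMod p, t ^ 3 + (a : ZMod p) * t ^ 2 + (b : ZMod p) * t + (c : ZMod p) ≠ 0) :
    Irreducible (MonicCubic.polyQ a b c) := by
  rw [MonicCubic.polyQ_eq]
  set f : ℚ[X] := X ^ 3 + C (a : ℚ) * X ^ 2 + C (b : ℚ) * X + C (c : ℚ) with hf
  have hdeg : f.natDegree = 3 := by rw [hf]; compute_degree!
  rw [irreducible_iff_roots_eq_zero_of_degree_le_three (by omega) (by omega)]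
  refine Multiset.eq_zero_of_forall_notMem fun r hr => ?_
  have hf0 : f ≠ 0 := by rintro h0; rw [h0, natDegree_zero] at hdeg; exact absurd hdeg (by decide)
  rw [mem_roots hf0, IsRoot.def, hf] at hr
  simp only [eval_add, eval_pow, eval_X, eval_mul, eval_C] at hr
  set fZ : ℤ[X] := X ^ 3 + C a * X ^ 2 + C b * X + C c with hfZ
  have hmonic : fZ.Monic := by rw [hfZ]; monicity!
  have haeval : aeval r fZ = 0 := by
    rw [hfZ]
    simp only [map_add, map_pow, aeval_X, map_mul, map_intCast, eq_intCast]
    exact_mod_cast hr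
  obtain ⟨n, hn, -⟩ := exists_integer_of_is_root_of_monic hmonic haeval
  rw [hn, algebraMap_int_eq, eq_intCast] at hr
  have hr' : n ^ 3 + a * n ^ 2 + b * n + c = 0 := by exact_mod_cast hr
  have hp := congrArg (Int.cast : ℤ → ZMod p) hr'
  push_cast at hp
  exact h _ hp

end Summit.BirchSwinnertonDyer.BirchSwinnertonDyer.Rank2Observatory.TwoDescCubic

end
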